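import Mathlib
import Summits.ResolutionOfSingularities.ResolutionOfSingularities.Theorems.RadicialJungCleanModelsPBasisFieldExchange
import Summits.ResolutionOfSingularities.ResolutionOfSingularities.Theorems.RadicialJungCleanModelsPBasisDualDerivations
import Summits.ResolutionOfSingularities.ResolutionOfSingularities.Theorems.RadicialJungCleanModelsPBasisDerivation
import Summits.ResolutionOfSingularities.ResolutionOfSingularities.Theorems.RadicialJungCleanModelsCleanLU3ArcDischarge
import Literature.AlgebraicGeometry.Resolution.TranscendenceDefect
import HarnessLib

/-!
# res-B-lens-5 g7 (lens 5): LEMMA D-abs — an ABSOLUTE derivation moving `g₀ ∉ K^p` with bounded denominators on `A` — PROVED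
# (rev 2: UNCONDITIONAL; the field-theory input LEMMA F₀ `HeightOneIntermediateFinite` is now a theorem of this file)

Crux of record: stmt-ResolutionOfSingularities-0549 (FIXED, not restated).  15917-side support for CLASS (A) of `stub_cleanLU3Defect` over an
ARBITRARY ground field `k` (memo `CLASSA-allfields-potential-lens5.md` e709ae1b8c5f §1): the corner `g₀ ∈ k K^p ∖ K^p`
(`stub_cleanLU3DefectArcConstants`, "no `k`-derivation moves `g₀`") is served by a derivation that is NOT `k`-linear.

* `HeightOneIntermediateFinite p` — LEMMA F₀: `F ≤ M ≤ F(w)` (`w` finite), `M^p ⊆ F` ⟹ `M ⊆ Σ_{j<f} F · μ_j`.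
  **PROVED** (`heightOneIntermediateFinite`, rev 2; pure Mathlib): induction on the generators `w`; an ALGEBRAIC generator `x₀`
  contributes the power basis of `F(x₀)` (`IntermediateField.adjoin.powerBasis`); for a TRANSCENDENTAL `x₀`, an `F`-linearly
  independent family in `M` stays `F(x₀)`-linearly independent (`LemmaF0.linearIndependent_adjoin_of_transcendental`: clear
  denominators, expand in powers of `x₀`, apply FROBENIUS — the coefficients `m_d ∈ M` have `m_d^p ∈ F` and `x₀^p` is transcendental
  over `F` — so no tower `F ≤ M ≤ K` instance is needed), whence `rank_F M ≤ #μ` (`rank_le`) and `M` is `F`-finite.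
* `absDerivation_of_forall_pow_ne` — LEMMA D-abs from LEMMA F₀ (rev 1, kept) and **`absDerivation_of_forall_pow_ne'` — LEMMA D-abs,
  UNCONDITIONAL** (rev 2): `(∀ c, c^p ≠ g₀)` ⟹ `∃ D s, s ≠ 0 ∧ s•D(A) ⊆ A ∧ D g₀ ≠ 0`, the conclusion of the lead's
  `stub_derivation_of_not_mem_adjoin_pow` under the WEAKER hypothesis `g₀ ∉ K^p`; `absDerivationMovesAt_holds : p.Prime → AbsDerivationMovesAt p`
  is the census target `Census_lens5_arcPotential.AbsDerivationMovesAt` (verbatim copy of the `def`) — so the census certificates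
  `arcConstants_of_absDerivation` / `derivationStub_of_absDerivation` / `…_of_potential_of_absDerivation` now have their `hD` input.
  Construction: `{g₀}` is `p`-independent; `B₁ ⊇ {g₀}` maximal `p`-independent inside `{g₀} ∪ k'` (`exists_maximal_pIndep`), so
  `k' ⊆ K^p[B₁] = L₀[g₀]` with `L₀ = K^p[B₁ ∖ {g₀}]`; `Γ ⊇ B₁` a `p`-basis; `D = ∂_{g₀}` kills `L₀`.  With `k₂ = k' ∩ L₀` one has
  `L₀[g₀] ⊆ k₂(x_1^p, …, x_m^p, g₀)` (`A = k[x]`, `K = Frac A`), so LEMMA F₀ gives `k' ⊆ Σ_j k₂ μ_j`, whence `D(k') ⊆ Σ_j k' · D μ_j` and the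
  denominators of `D` on `A` are bounded by `∏_{x} den(D x) · ∏_j den(D μ_j)`.
* **`cleanLU3DefectArcConstants` — the lead's registered stub `stub_cleanLU3DefectArcConstants` (`Cruxes/CleanModels/Lines/Sketch.lean`
  rev 20 l.232, sha16 0ed627d06d47d46d), statement VERBATIM, PROVED** (rev 2): LEMMA D-abs feeds the landed
  ✓ `cleanLU3Defect_of_discrete_of_finiteResidue` (which accepts any absolute `Derivation ℤ K K`); the hypothesis `g₀ ∈ k[K^p]` is unused.
  The lead may land it verbatim as `Theorems/RadicialJungCleanModelsCleanLU3DefectArcConstants.lean --supports stmt-…-15917`.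
bears_on: LADDER-RESOLUTION:B · [OURS · CANDIDATE] counted 0; nothing here proves resolution in characteristic `p`.
-/

noncomputable section

set_option linter.dupNamespace false

open Polynomial
open IsLocalRing
open Literature.AlgebraicGeometry.Resolution
open Literature.RingTheory.PBasis
open Summit.ResolutionOfSingularities.ResolutionOfSingularities.Theorems.RadicialJung.CleanModels

namespace Summit.ResolutionOfSingularities.ResolutionOfSingularities.Cruxes.DescentPerfectToAll.CpSibling.AbsDerivation

section Tools

variable {K : Type} [Field K] (p : ℕ) [Fact p.Prime] [CharP K p]

/-- The empty family is `p`-independent. [folklore] -/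
theorem pIndep_empty : ∀ (s : ℕ) (b : Fin s → K), Function.Injective b → (∀ i, b i ∈ (∅ : Set K)) →
    LinearIndependent (frobenius K p).range (fun n : Fin s → Fin p => ∏ i, b i ^ (n i : ℕ)) := by
  intro s b _ hmem
  rcases Nat.eq_zero_or_pos s with rfl | hs
  · rw [Fintype.linearIndependent_iff]
    intro g hg n
    rw [Finset.sum_eq_single n (fun n' _ hn' => absurd (Subsingleton.elim n' n) hn')
      (fun h => absurd (Finset.mem_univ n) h)] at hg
    simp only [Finset.univ_eq_empty, Finset.prod_empty, Subring.smul_def, smul_eq_mul,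
      mul_one] at hg
    exact Subtype.ext hg
  · exact absurd (hmem ⟨0, hs⟩) (Set.notMem_empty _)

/-- A `p`-independent generating set is a `p`-basis over `K^p` (`IsPBasisOver`). [folklore] -/
theorem isPBasisOver_of_pIndep_of_univ_subset {Γ : Set K}
    (hind : ∀ (s : ℕ) (b : Fin s → K), Function.Injective b → (∀ i, b i ∈ Γ) →
      LinearIndependent (frobenius K p).range (fun n : Fin s → Fin p => ∏ i, b i ^ (n i : ℕ)))
    (hgen : Set.univ ⊆ (Subring.closure (Set.range (frobenius K p) ∪ Γ) : Set K)) :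
    IsPBasisOver p (frobenius K p).range Γ := by
  refine ⟨?_, hind⟩
  rw [eq_top_iff]
  intro x _
  rw [Algebra.mem_adjoin_iff]
  have hr : Set.range (algebraMap (frobenius K p).range K) = Set.range (frobenius K p) := by
    ext z
    constructor
    · rintro ⟨⟨w, y, hy⟩, rfl⟩
      exact ⟨y, hy⟩
    · rintro ⟨y, rfl⟩
      exact ⟨⟨frobenius K p y, y, rfl⟩, rfl⟩
  rw [hr]
  exact hgen (Set.mem_univ x)

/-- A derivation killing `B` kills `K^p[B] = Subring.closure (K^p ∪ B)`. [folklore] -/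
theorem derivation_eq_zero_of_mem_closure (D : Derivation ℤ K K) {B : Set K} (hB : ∀ b ∈ B, D b = 0)
    {x : K} (hx : x ∈ Subring.closure (Set.range (frobenius K p) ∪ B)) : D x = 0 := by
  induction hx using Subring.closure_induction with
  | mem y hy =>
    rcases hy with ⟨w, rfl⟩ | hy
    · rw [frobenius_def]
      exact derivation_pow_char D w
    · exact hB y hy
  | zero => exact map_zero D
  | one => exact D.map_one_eq_zero
  | add a b _ _ ha hb => rw [map_add, ha, hb, add_zero]
  | neg a _ ha => rw [map_neg, ha, neg_zero]
  | mul a b _ _ ha hb => rw [D.leibniz, ha, hb, smul_zero, smul_zero, add_zero]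

end Tools

/-! ## LEMMA F₀ (pure field theory, Mathlib only) -/

namespace LemmaF0

variable {K : Type} [Field K]

theorem range_algebraMap_subfield (F : Subfield K) : Set.range (algebraMap F K) = (F : Set K) := by
  ext z
  constructor
  · rintro ⟨c, rfl⟩
    exact c.2
  · intro hz
    exact ⟨⟨z, hz⟩, rfl⟩

theorem mem_closure_iff_mem_adjoin (F : Subfield K) (x₀ z : K) :
    z ∈ Subfield.closure ((F : Set K) ∪ {x₀}) ↔ z ∈ IntermediateField.adjoin F ({x₀} : Set K) := by
  rw [← IntermediateField.mem_toSubfield, IntermediateField.adjoin_toSubfield, range_algebraMap_subfield]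

/-- (i) If `x₀` is algebraic over `F`, then `F(x₀)` is contained in a finite `F`-span. [folklore] -/
theorem exists_span_of_isAlgebraic (F : Subfield K) {x₀ : K} (hx : IsAlgebraic F x₀) :
    ∃ (d : ℕ) (ρ : Fin d → K), ∀ z ∈ Subfield.closure ((F : Set K) ∪ {x₀}),
      ∃ b : Fin d → K, (∀ i, b i ∈ F) ∧ z = ∑ i, b i * ρ i := by
  have hint : IsIntegral F x₀ := isAlgebraic_iff_isIntegral.mp hx
  let pb := IntermediateField.adjoin.powerBasis hint
  refine ⟨pb.dim, fun i => (pb.basis i : K), fun z hz => ?_⟩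
  rw [mem_closure_iff_mem_adjoin] at hz
  refine ⟨fun i => (pb.basis.repr ⟨z, hz⟩ i : K), fun i => Subtype.coe_prop _, ?_⟩
  have key := congrArg (fun y : IntermediateField.adjoin F ({x₀} : Set K) => (y : K))
    (pb.basis.sum_repr ⟨z, hz⟩)
  simp only at key
  calc z = _ := key.symm
    _ = _ := by
      rw [IntermediateField.coe_sum]
      refine Finset.sum_congr rfl fun i _ => ?_
      rw [IntermediateField.coe_smul, Algebra.smul_def]
      rfl

/-- (ii) If `x₀` is transcendental over `F`, `F ≤ M` with `M^p ⊆ F`, then an `F`-linearly independent family of elements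
of `M` stays `F(x₀)`-linearly independent. [folklore] -/
theorem linearIndependent_adjoin_of_transcendental {p : ℕ} [Fact p.Prime] [CharP K p]
    (F M : Subfield K) (hFM : F ≤ M) (hMp : ∀ y ∈ M, y ^ p ∈ F) {x₀ : K} (hx : Transcendental F x₀)
    {ι : Type} [Fintype ι] {ν : ι → K} (hνM : ∀ i, ν i ∈ M) (hind : LinearIndependent F ν) :
    LinearIndependent (Subfield.closure ((F : Set K) ∪ {x₀})) ν := by
  classical
  have hp : p.Prime := Fact.out
  set F' := Subfield.closure ((F : Set K) ∪ {x₀}) with hF'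
  rw [Fintype.linearIndependent_iff] at hind ⊢
  intro c hc
  have hc' : ∑ i, ((c i : F') : K) * ν i = 0 := by
    simp_rw [Algebra.smul_def] at hc
    exact hc
  -- each `c i = P/Q` with `Q(x₀) ≠ 0`
  have hPQ : ∀ i, ∃ P Q : (F)[X], aeval x₀ Q ≠ 0 ∧ ((c i : F') : K) = aeval x₀ P / aeval x₀ Q := by
    intro i
    obtain ⟨P, Q, h⟩ := (IntermediateField.mem_adjoin_simple_iff (F := F) (α := x₀) ((c i : F') : K)).mp
      ((mem_closure_iff_mem_adjoin F x₀ _).mp (c i).2)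
    by_cases hQ : aeval x₀ Q = 0
    · refine ⟨0, 1, by simp, ?_⟩
      rw [h, hQ, div_zero, map_zero, map_one, zero_div]
    · exact ⟨P, Q, hQ, h⟩
  choose P Q hQ hcPQ using hPQ
  -- clear denominators: `R i := P i * ∏_{i' ≠ i} Q i'`, `aeval x₀ (R i) = c i * D`
  set R : ι → (F)[X] := fun i => P i * ∏ i' ∈ Finset.univ.erase i, Q i' with hR
  have hRc : ∀ i, aeval x₀ (R i) = ((c i : F') : K) * ∏ i', aeval x₀ (Q i') := by
    intro i
    simp only [hR, map_mul, map_prod]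
    rw [hcPQ i, ← Finset.mul_prod_erase Finset.univ (fun i' => aeval x₀ (Q i')) (Finset.mem_univ i),
      div_mul_eq_mul_div, mul_left_comm, mul_div_cancel_left₀ _ (hQ i)]
  have hrel : ∑ i, aeval x₀ (R i) * ν i = 0 := by
    simp_rw [hRc, mul_right_comm _ _ (ν _)]
    rw [← Finset.sum_mul, hc', zero_mul]
  -- expand in powers of `x₀`
  set N := Finset.univ.sup (fun i => (R i).natDegree) + 1 with hN
  have hdeg : ∀ i, (R i).natDegree < N := fun i =>
    Nat.lt_succ_of_le (Finset.le_sup (f := fun i => (R i).natDegree) (Finset.mem_univ i))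
  have hexp : ∀ i, aeval x₀ (R i) = ∑ d ∈ Finset.range N, (((R i).coeff d : F) : K) * x₀ ^ d := by
    intro i
    rw [aeval_eq_sum_range' (hdeg i)]
    refine Finset.sum_congr rfl fun d _ => ?_
    rw [Algebra.smul_def]
    rfl
  set m : ℕ → K := fun d => ∑ i, (((R i).coeff d : F) : K) * ν i with hm
  have hmM : ∀ d, m d ∈ M := fun d =>
    sum_mem fun i _ => mul_mem (hFM ((R i).coeff d).2) (hνM i)
  have hsum : ∑ d ∈ Finset.range N, m d * x₀ ^ d = 0 := by
    rw [← hrel]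
    simp_rw [hexp, hm, Finset.sum_mul]
    rw [Finset.sum_comm]
    refine Finset.sum_congr rfl fun i _ => Finset.sum_congr rfl fun d _ => ?_
    ring
  -- Frobenius
  have hsum' : ∑ d ∈ Finset.range N, (m d) ^ p * (x₀ ^ p) ^ d = 0 := by
    have h := congrArg (frobenius K p) hsum
    rw [map_sum, map_zero] at h
    rw [← h]
    refine Finset.sum_congr rfl fun d _ => ?_
    rw [frobenius_def, mul_pow, ← pow_mul, ← pow_mul, mul_comm p d]
  have hmF : ∀ d, (m d) ^ p ∈ F := fun d => hMp _ (hmM d)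
  set Φ : (F)[X] := ∑ d ∈ Finset.range N, C (⟨(m d) ^ p, hmF d⟩ : F) * X ^ d with hΦ
  have hΦeval : aeval (x₀ ^ p) Φ = 0 := by
    rw [hΦ, map_sum, ← hsum']
    refine Finset.sum_congr rfl fun d _ => ?_
    rw [map_mul, map_pow, aeval_C, aeval_X]
    rfl
  have hxp : Transcendental F (x₀ ^ p) := hx.pow hp.pos
  have hΦ0 : Φ = 0 := (transcendental_iff_injective.mp hxp) (by rw [hΦeval, map_zero])
  have hmd : ∀ d ∈ Finset.range N, m d = 0 := by
    intro d hd
    have hcoef : Φ.coeff d = ⟨(m d) ^ p, hmF d⟩ := by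
      rw [hΦ, finsetSum_coeff]
      simp_rw [coeff_C_mul_X_pow]
      rw [Finset.sum_ite_eq, if_pos hd]
    rw [hΦ0, coeff_zero] at hcoef
    have h0 : (m d) ^ p = 0 := by
      have := congrArg Subtype.val hcoef
      simpa using this.symm
    exact (pow_eq_zero_iff hp.ne_zero).mp h0
  -- all coefficients of `R i` vanish
  have hcoeff : ∀ i d, (R i).coeff d = 0 := by
    intro i d
    by_cases hd : d < N
    · have h0 : ∑ i, (((R i).coeff d : F) : K) * ν i = 0 := hmd d (Finset.mem_range.mpr hd)
      refine hind (fun i => (R i).coeff d) ?_ i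
      simp_rw [Algebra.smul_def]
      exact h0
    · exact coeff_eq_zero_of_natDegree_lt (lt_of_lt_of_le (hdeg i) (not_lt.mp hd))
  have hR0 : ∀ i, R i = 0 := fun i => Polynomial.ext fun d => by rw [hcoeff, coeff_zero]
  have hQ0 : ∀ i, Q i ≠ 0 := fun i h => hQ i (by rw [h, map_zero])
  have hP0 : ∀ i, P i = 0 := by
    intro i
    have h := hR0 i
    simp only [hR] at h
    exact (mul_eq_zero.mp h).resolve_right (Finset.prod_ne_zero_iff.mpr fun i' _ => hQ0 i')
  intro i
  apply Subtype.ext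
  rw [hcPQ i, hP0, map_zero, zero_div]
  rfl

/-- LEMMA F₀, general-index form, by induction on the generators. -/
theorem finite_span_aux {p : ℕ} [Fact p.Prime] [CharP K p] (w : Finset K) :
    ∀ (F M : Subfield K), F ≤ M → (∀ x ∈ M, x ^ p ∈ F) →
      (M : Set K) ⊆ (Subfield.closure ((F : Set K) ∪ ↑w) : Set K) →
      ∃ (ι : Type) (_ : Fintype ι) (μ : ι → K), ∀ x ∈ M, ∃ a : ι → K, (∀ i, a i ∈ F) ∧ x = ∑ i, a i * μ i := by
  classical
  induction w using Finset.induction_on with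
  | empty =>
    intro F M hFM hMp hMw
    refine ⟨Unit, inferInstance, fun _ => 1, fun x hx => ⟨fun _ => x, fun _ => ?_, by simp⟩⟩
    have : x ∈ Subfield.closure ((F : Set K) ∪ ↑(∅ : Finset K)) := hMw hx
    rwa [Finset.coe_empty, Set.union_empty, Subfield.closure_eq] at this
  | insert x₀ w _ ih =>
    intro F M hFM hMp hMw
    set F' : Subfield K := Subfield.closure ((F : Set K) ∪ {x₀}) with hF'def
    have hFF' : F ≤ F' := fun z hz => Subfield.subset_closure (Or.inl hz)
    have hx₀F' : x₀ ∈ F' := Subfield.subset_closure (Or.inr rfl)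
    set M' : Subfield K := M ⊔ F' with hM'def
    have hF'M' : F' ≤ M' := le_sup_right
    have hMM' : M ≤ M' := le_sup_left
    have hM'p : ∀ y ∈ M', y ^ p ∈ F' := by
      have hle : M' ≤ F'.comap (frobenius K p) := by
        refine sup_le (fun y hy => ?_) (fun y hy => ?_)
        · rw [Subfield.mem_comap, frobenius_def]
          exact hFF' (hMp y hy)
        · rw [Subfield.mem_comap, frobenius_def]
          exact pow_mem hy p
      intro y hy
      have := hle hy
      rwa [Subfield.mem_comap, frobenius_def] at this
    have hM'w : (M' : Set K) ⊆ (Subfield.closure ((F' : Set K) ∪ ↑w) : Set K) := by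
      have hle : M' ≤ Subfield.closure ((F' : Set K) ∪ ↑w) := by
        refine sup_le (fun y hy => ?_) (fun y hy => Subfield.subset_closure (Or.inl hy))
        refine Subfield.closure_mono ?_ (hMw hy)
        rintro z (hz | hz)
        · exact Or.inl (hFF' hz)
        · rw [Finset.coe_insert, Set.mem_insert_iff] at hz
          rcases hz with rfl | hz
          · exact Or.inl hx₀F'
          · exact Or.inr hz
      exact hle
    obtain ⟨ι, _, μ, hμ⟩ := ih F' M' hF'M' hM'p hM'w
    by_cases halg : IsAlgebraic F x₀
    · -- algebraic generator: compose the two finite spans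
      obtain ⟨d, ρ, hρ⟩ := exists_span_of_isAlgebraic F halg
      refine ⟨ι × Fin d, inferInstance, fun ji => ρ ji.2 * μ ji.1, fun x hx => ?_⟩
      obtain ⟨a, haF', hxa⟩ := hμ x (hMM' hx)
      choose b hbF hab using fun j => hρ (a j) (haF' j)
      refine ⟨fun ji => b ji.1 ji.2, fun ji => hbF _ _, ?_⟩
      rw [hxa, Fintype.sum_prod_type]
      refine Finset.sum_congr rfl fun j _ => ?_
      rw [hab j, Finset.sum_mul]
      refine Finset.sum_congr rfl fun i _ => ?_
      ring
    · -- transcendental generator: rank argument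
      have htr : Transcendental F x₀ := halg
      let MF : Submodule F K :=
        { carrier := M
          add_mem' := fun ha hb => M.add_mem ha hb
          zero_mem' := M.zero_mem
          smul_mem' := fun c x hx => by
            rw [Algebra.smul_def]
            exact M.mul_mem (hFM c.2) hx }
      haveI : Module.Finite F' (Submodule.span F' (Set.range μ)) :=
        Module.Finite.span_of_finite _ (Set.finite_range μ)
      have hbound : ∀ s : Finset MF, (LinearIndependent F fun i : s => (i : MF)) →
          s.card ≤ Fintype.card ι := by
        intro s hli
        let ν : s → K := fun i => ((i : MF) : K)
        have hνM : ∀ i, ν i ∈ M := fun i => (i : MF).2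
        have hν : LinearIndependent F ν := hli.map' MF.subtype (Submodule.ker_subtype MF)
        have hν' := linearIndependent_adjoin_of_transcendental F M hFM hMp htr hνM hν
        have hνW : ∀ i, ν i ∈ Submodule.span F' (Set.range μ) := by
          intro i
          obtain ⟨a, haF', h⟩ := hμ (ν i) (hMM' (hνM i))
          rw [h]
          refine Submodule.sum_mem _ fun j _ => ?_
          have h1 : a j * μ j = (⟨a j, haF' j⟩ : F') • μ j := by
            rw [Algebra.smul_def]
            rfl
          rw [h1]
          exact Submodule.smul_mem _ _ (Submodule.subset_span (Set.mem_range_self j))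
        let ν' : s → Submodule.span F' (Set.range μ) := fun i => ⟨ν i, hνW i⟩
        have hν'ind : LinearIndependent F' ν' :=
          LinearIndependent.of_comp (Submodule.span F' (Set.range μ)).subtype hν'
        have h1 := hν'ind.fintype_card_le_finrank
        have h2 := finrank_range_le_card (R := F') μ
        rw [Fintype.card_coe] at h1
        exact h1.trans h2
      have hrank : Module.rank F MF ≤ Fintype.card ι := rank_le hbound
      haveI : Module.Free F MF := Module.Free.of_divisionRing F MF
      haveI : Module.Finite F MF := by
        rw [← Module.rank_lt_aleph0_iff]
        exact lt_of_le_of_lt hrank (Cardinal.natCast_lt_aleph0 (n := Fintype.card ι))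
      obtain ⟨n, s, hs⟩ := Module.Finite.exists_fin (R := F) (M := MF)
      refine ⟨Fin n, inferInstance, fun i => (s i : K), fun x hx => ?_⟩
      have hxs : (⟨x, hx⟩ : MF) ∈ Submodule.span F (Set.range s) := by
        rw [hs]
        exact Submodule.mem_top
      rw [Submodule.mem_span_range_iff_exists_fun] at hxs
      obtain ⟨c, hc⟩ := hxs
      refine ⟨fun i => (c i : K), fun i => (c i).2, ?_⟩
      have h := congrArg (fun y : MF => (y : K)) hc
      simp only at h
      rw [← h, Submodule.coe_sum]
      refine Finset.sum_congr rfl fun i _ => ?_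
      rw [Submodule.coe_smul, Algebra.smul_def]
      rfl

/-- **LEMMA F₀.** [folklore] -/
theorem heightOneIntermediateFinite (p : ℕ) (hp : p.Prime) :
    ∀ (K : Type) [Field K] [CharP K p] (F M : Subfield K) (w : Finset K),
      F ≤ M → (∀ x ∈ M, x ^ p ∈ F) → (M : Set K) ⊆ (Subfield.closure ((F : Set K) ∪ ↑w) : Set K) →
      ∃ (f : ℕ) (μ : Fin f → K), ∀ x ∈ M, ∃ a : Fin f → K, (∀ j, a j ∈ F) ∧ x = ∑ j, a j * μ j := by
  intro K _ _ F M w hFM hMp hMw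
  haveI : Fact p.Prime := ⟨hp⟩
  classical
  obtain ⟨ι, _, μ, hμ⟩ := finite_span_aux w F M hFM hMp hMw
  refine ⟨Fintype.card ι, fun j => μ ((Fintype.equivFin ι).symm j), fun x hx => ?_⟩
  obtain ⟨a, haF, hxa⟩ := hμ x hx
  refine ⟨fun j => a ((Fintype.equivFin ι).symm j), fun j => haF _, ?_⟩
  rw [hxa]
  exact (Equiv.sum_comp (Fintype.equivFin ι).symm (fun i => a i * μ i)).symm

end LemmaF0


/-- **LEMMA F₀ (hypothesis).**  Height-one purely inseparable intermediate fields of a finitely generated extension are finite: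
if `F ≤ M` are subfields of `K` (characteristic `p`), `x^p ∈ F` for every `x ∈ M`, and `M ⊆ F(w)` for a finite `w ⊆ K`, then `M` is
contained in the `F`-span of finitely many elements.  [folklore] (intermediate fields of finitely generated extensions are finitely
generated; algebraic + finitely generated ⟹ finite.)  Used only for prime `p`. -/
def HeightOneIntermediateFinite (p : ℕ) : Prop :=
  ∀ (K : Type) [Field K] [CharP K p] (F M : Subfield K) (w : Finset K),
    F ≤ M → (∀ x ∈ M, x ^ p ∈ F) → (M : Set K) ⊆ (Subfield.closure ((F : Set K) ∪ ↑w) : Set K) →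
    ∃ (f : ℕ) (μ : Fin f → K), ∀ x ∈ M, ∃ a : Fin f → K, (∀ j, a j ∈ F) ∧ x = ∑ j, a j * μ j

/-- **LEMMA D-abs from LEMMA F₀.**  For a finitely generated `k`-algebra `A` with fraction field `K` (characteristic `p`) and `g₀ ∈ K`
not a `p`-th power, there is a derivation `D` of `K` (over `ℤ`; in general NOT `k`-linear) with `D g₀ ≠ 0` and `s • D(A) ⊆ A` for some
`s ≠ 0`. [folklore] -/
theorem absDerivation_of_forall_pow_ne (p : ℕ) (hp : p.Prime) (hF : HeightOneIntermediateFinite p)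
    (k : Type) [Field k] [CharP k p] (K : Type) [Field K] [Algebra k K] (A : Subalgebra k K)
    (hAfg : A.FG) (hfrac : IsFractionRing A K) (g₀ : K) (hg : ∀ c : K, c ^ p ≠ g₀) :
    ∃ (D : Derivation ℤ K K) (s : K), s ≠ 0 ∧ (∀ y : K, y ∈ A → s * D y ∈ A) ∧ D g₀ ≠ 0 := by
  classical
  haveI : Fact p.Prime := ⟨hp⟩
  haveI : CharP K p := charP_of_injective_algebraMap (algebraMap k K).injective p
  obtain ⟨t, rfl⟩ := hAfg
  haveI := hfrac
  -- Step 1: `{g₀}` is `p`-independent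
  have hg₀cl : g₀ ∉ Subring.closure (Set.range (frobenius K p) ∪ (∅ : Set K)) := by
    rw [Set.union_empty, ← RingHom.coe_range, Subring.closure_eq]
    intro h
    obtain ⟨c, hc⟩ := RingHom.mem_range.mp h
    exact hg c (by rw [← frobenius_def]; exact hc)
  have hB₀ind := pIndep_insert p ∅ (pIndep_empty p) hg₀cl
  -- Step 2: `B₁ ⊇ {g₀}` maximal `p`-independent inside `{g₀} ∪ k'`
  obtain ⟨B₁, hB₀B₁, hB₁Y, hB₁ind, hYB₁⟩ :=
    exists_maximal_pIndep p (insert g₀ (Set.range (algebraMap k K))) (insert g₀ ∅)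
      (Set.insert_subset_insert (Set.empty_subset _)) hB₀ind
  have hg₀B₁ : g₀ ∈ B₁ := hB₀B₁ (Set.mem_insert _ _)
  -- Step 3: a `p`-basis `Γ ⊇ B₁` and the dual derivation at `g₀`
  obtain ⟨Γ, hB₁Γ, -, hΓind, hΓgen⟩ := exists_maximal_pIndep p Set.univ B₁ (Set.subset_univ _) hB₁ind
  have hΓ : IsPBasisOver p (frobenius K p).range Γ := isPBasisOver_of_pIndep_of_univ_subset p hΓind hΓgen
  have hg₀Γ : g₀ ∈ Γ := hB₁Γ hg₀B₁
  obtain ⟨D, hDg₀, hDΓ⟩ := IsPBasisOver.exists_dual_derivation hΓ ⟨g₀, hg₀Γ⟩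
  -- Step 4: `D` kills `B₁' = B₁ ∖ {g₀}` and `L₀ = K^p[B₁']`
  set B₁' : Set K := B₁ \ {g₀} with hB₁'
  have hDB₁' : ∀ b ∈ B₁', D b = 0 := by
    rintro b ⟨hb, hbg⟩
    exact hDΓ ⟨b, hB₁Γ hb⟩ fun h => hbg (congrArg Subtype.val h)
  have hDL₀ : ∀ x ∈ Subring.closure (Set.range (frobenius K p) ∪ B₁'), D x = 0 := fun x hx =>
    derivation_eq_zero_of_mem_closure p D hDB₁' hx
  have hB₁'k' : B₁' ⊆ Set.range (algebraMap k K) := by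
    rintro b ⟨hb, hbg⟩
    rcases hB₁Y hb with h | h
    · exact absurd h hbg
    · exact h
  -- the subfields `L₀ = K^p(B₁')`, `k' = im k`, `k₂ = k' ∩ L₀`
  let L₀ : Subfield K := Subfield.closure (Set.range (frobenius K p) ∪ B₁')
  have hL₀mem : ∀ z, z ∈ L₀ ↔ z ∈ Subring.closure (Set.range (frobenius K p) ∪ B₁') :=
    fun z => mem_subfieldClosure_iff p _ Set.subset_union_left z
  let kf : Subfield K := (algebraMap k K).fieldRange
  let k₂ : Subfield K := kf ⊓ L₀
  have hk₂A : ∀ z ∈ k₂, z ∈ Algebra.adjoin k (↑t : Set K) := by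
    intro z hz
    obtain ⟨c, rfl⟩ := RingHom.mem_fieldRange.mp (Subfield.mem_inf.mp hz).1
    exact Subalgebra.algebraMap_mem _ c
  have hk₂D : ∀ z ∈ k₂, D z = 0 := fun z hz =>
    hDL₀ z ((hL₀mem z).mp (Subfield.mem_inf.mp hz).2)
  -- Step 5: the finiteness input, applied to `k₂ ≤ k' ≤ k₂(x^p, g₀)`
  let w : Finset K := insert g₀ (t.image fun x => x ^ p)
  have hFM : k₂ ≤ kf := inf_le_left
  have hpow : ∀ x ∈ kf, x ^ p ∈ k₂ := fun x hx =>
    Subfield.mem_inf.mpr ⟨pow_mem hx p, (hL₀mem _).mpr (Subring.subset_closure (Or.inl ⟨x, frobenius_def ..⟩))⟩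
  have hMN : (kf : Set K) ⊆ (Subfield.closure ((k₂ : Set K) ∪ ↑w) : Set K) := by
    -- (a) `p`-th powers of elements of `A`, hence of `K = Frac A`, lie in `N = k₂(w)`
    have hA_N : ∀ z ∈ Algebra.adjoin k (↑t : Set K), z ^ p ∈ Subfield.closure ((k₂ : Set K) ∪ ↑w) := by
      intro z hz
      rw [Algebra.mem_adjoin_iff] at hz
      have hle : Subring.closure (Set.range (algebraMap k K) ∪ ↑t) ≤
          ((Subfield.closure ((k₂ : Set K) ∪ ↑w)).comap (frobenius K p)).toSubring := by
        rw [Subring.closure_le]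
        rintro x (⟨c, rfl⟩ | hx)
        · show frobenius K p (algebraMap k K c) ∈ Subfield.closure ((k₂ : Set K) ∪ ↑w)
          rw [frobenius_def]
          exact Subfield.subset_closure (Or.inl (hpow _ (RingHom.mem_fieldRange.mpr ⟨c, rfl⟩)))
        · show frobenius K p x ∈ Subfield.closure ((k₂ : Set K) ∪ ↑w)
          rw [frobenius_def]
          exact Subfield.subset_closure (Or.inr (Finset.mem_coe.mpr
            (Finset.mem_insert_of_mem (Finset.mem_image_of_mem _ (Finset.mem_coe.mp hx)))))
      have := hle hz
      rw [Subfield.mem_toSubring, Subfield.mem_comap, frobenius_def] at this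
      exact this
    have hK_N : ∀ c : K, c ^ p ∈ Subfield.closure ((k₂ : Set K) ∪ ↑w) := by
      intro c
      obtain ⟨x, y, -, hxy⟩ := IsFractionRing.div_surjective (A := Algebra.adjoin k (↑t : Set K)) c
      rw [← hxy]
      change ((x : K) / (y : K)) ^ p ∈ _
      rw [div_pow]
      exact div_mem (hA_N x x.2) (hA_N y y.2)
    -- (b) `k' ⊆ K^p[B₁] ⊆ N`
    intro z hz
    obtain ⟨c, rfl⟩ := RingHom.mem_fieldRange.mp hz
    have h1 : algebraMap k K c ∈ Subring.closure (Set.range (frobenius K p) ∪ B₁) :=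
      hYB₁ (Set.mem_insert_of_mem _ ⟨c, rfl⟩)
    have hle : Subring.closure (Set.range (frobenius K p) ∪ B₁) ≤
        (Subfield.closure ((k₂ : Set K) ∪ ↑w)).toSubring := by
      rw [Subring.closure_le]
      rintro x (⟨y, rfl⟩ | hx)
      · show frobenius K p y ∈ Subfield.closure ((k₂ : Set K) ∪ ↑w)
        rw [frobenius_def]
        exact hK_N y
      · show x ∈ Subfield.closure ((k₂ : Set K) ∪ ↑w)
        by_cases hxg : x = g₀
        · rw [hxg]
          exact Subfield.subset_closure (Or.inr (Finset.mem_coe.mpr (Finset.mem_insert_self g₀ _)))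
        · have hx' : x ∈ B₁' := ⟨hx, hxg⟩
          exact Subfield.subset_closure (Or.inl (Subfield.mem_inf.mpr
            ⟨RingHom.mem_fieldRange.mpr (hB₁'k' hx'), (hL₀mem _).mpr (Subring.subset_closure (Or.inr hx'))⟩))
    exact hle h1
  obtain ⟨f, μ, hμ⟩ := hF K k₂ kf w hFM hpow hMN
  -- Step 6: denominators
  have hfr := fun x : K => IsFractionRing.div_surjective (A := Algebra.adjoin k (↑t : Set K)) (D x)
  choose a b hb hab using hfr
  have hb0 : ∀ x, ((b x : Algebra.adjoin k (↑t : Set K)) : K) ≠ 0 := fun x h =>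
    nonZeroDivisors.ne_zero (hb x) (Subtype.ext h)
  have hDx : ∀ x, D x = ((a x : Algebra.adjoin k (↑t : Set K)) : K) / ((b x : Algebra.adjoin k (↑t : Set K)) : K) :=
    fun x => (hab x).symm
  set s : K := (∏ x ∈ t, ((b x : Algebra.adjoin k (↑t : Set K)) : K)) *
    ∏ j : Fin f, ((b (μ j) : Algebra.adjoin k (↑t : Set K)) : K) with hs
  have hs0 : s ≠ 0 := mul_ne_zero (Finset.prod_ne_zero_iff.mpr fun x _ => hb0 x)
    (Finset.prod_ne_zero_iff.mpr fun j _ => hb0 (μ j))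
  -- `s * D z ∈ A` as soon as `s = r * den(D z)` with `r ∈ A`
  have hkey : ∀ (z r : K), r ∈ Algebra.adjoin k (↑t : Set K) →
      s = r * ((b z : Algebra.adjoin k (↑t : Set K)) : K) → s * D z ∈ Algebra.adjoin k (↑t : Set K) := by
    intro z r hr hsr
    rw [hsr, hDx z, mul_assoc, mul_div_assoc', mul_div_cancel_left₀ _ (hb0 z)]
    exact Subalgebra.mul_mem _ hr (a z).2
  have hst : ∀ x ∈ t, s * D x ∈ Algebra.adjoin k (↑t : Set K) := by
    intro x hx
    refine hkey x ((∏ z ∈ t.erase x, ((b z : Algebra.adjoin k (↑t : Set K)) : K)) *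
      ∏ j : Fin f, ((b (μ j) : Algebra.adjoin k (↑t : Set K)) : K)) ?_ ?_
    · exact Subalgebra.mul_mem _ (Subalgebra.prod_mem _ fun z _ => (b z).2)
        (Subalgebra.prod_mem _ fun j _ => (b (μ j)).2)
    · rw [hs, ← Finset.mul_prod_erase t (fun x => ((b x : Algebra.adjoin k (↑t : Set K)) : K)) hx]
      ring
  have hsμ : ∀ j, s * D (μ j) ∈ Algebra.adjoin k (↑t : Set K) := by
    intro j
    refine hkey (μ j) ((∏ x ∈ t, ((b x : Algebra.adjoin k (↑t : Set K)) : K)) *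
      ∏ j' ∈ Finset.univ.erase j, ((b (μ j') : Algebra.adjoin k (↑t : Set K)) : K)) ?_ ?_
    · exact Subalgebra.mul_mem _ (Subalgebra.prod_mem _ fun z _ => (b z).2)
        (Subalgebra.prod_mem _ fun j' _ => (b (μ j')).2)
    · rw [hs, ← Finset.mul_prod_erase Finset.univ
        (fun j' => ((b (μ j') : Algebra.adjoin k (↑t : Set K)) : K)) (Finset.mem_univ j)]
      ring
  -- `D` on the constants: `D(Σ a_j μ_j) = Σ a_j D μ_j`
  have hsk : ∀ c : k, s * D (algebraMap k K c) ∈ Algebra.adjoin k (↑t : Set K) := by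
    intro c
    obtain ⟨a', ha', hc⟩ := hμ (algebraMap k K c) (RingHom.mem_fieldRange.mpr ⟨c, rfl⟩)
    rw [hc, map_sum, Finset.mul_sum]
    refine Subalgebra.sum_mem _ fun j _ => ?_
    rw [D.leibniz, hk₂D _ (ha' j), smul_zero, add_zero, smul_eq_mul, mul_left_comm]
    exact Subalgebra.mul_mem _ (hk₂A _ (ha' j)) (hsμ j)
  refine ⟨D, s, hs0, fun y hy => ?_, ?_⟩
  · induction hy using Algebra.adjoin_induction with
    | mem x hx => exact hst x (Finset.mem_coe.mp hx)
    | algebraMap c => exact hsk c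
    | add x y _ _ hx' hy' =>
      rw [map_add, mul_add]
      exact Subalgebra.add_mem _ hx' hy'
    | mul x y hx hy hx' hy' =>
      have h1 : s * D (x * y) = x * (s * D y) + y * (s * D x) := by
        rw [D.leibniz, smul_eq_mul, smul_eq_mul]
        ring
      rw [h1]
      exact Subalgebra.add_mem _ (Subalgebra.mul_mem _ hx hy') (Subalgebra.mul_mem _ hy hx')
  · rw [hDg₀]
    exact one_ne_zero

/-- **LEMMA F₀ holds** (for prime `p`). [folklore] -/
theorem heightOneIntermediateFinite (p : ℕ) (hp : p.Prime) : HeightOneIntermediateFinite p :=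
  LemmaF0.heightOneIntermediateFinite p hp

/-- **LEMMA D-abs, UNCONDITIONAL** (rev 2). [folklore] -/
theorem absDerivation_of_forall_pow_ne' (p : ℕ) (hp : p.Prime)
    (k : Type) [Field k] [CharP k p] (K : Type) [Field K] [Algebra k K] (A : Subalgebra k K)
    (hAfg : A.FG) (hfrac : IsFractionRing A K) (g₀ : K) (hg : ∀ c : K, c ^ p ≠ g₀) :
    ∃ (D : Derivation ℤ K K) (s : K), s ≠ 0 ∧ (∀ y : K, y ∈ A → s * D y ∈ A) ∧ D g₀ ≠ 0 :=
  absDerivation_of_forall_pow_ne p hp (heightOneIntermediateFinite p hp) k K A hAfg hfrac g₀ hg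

/-- Verbatim copy of the census target `Census_lens5_arcPotential.lean : CpSibling.ArcPotential.AbsDerivationMovesAt`
(crux workfiles are not importable from one another on the farm). -/
def AbsDerivationMovesAt (p : ℕ) : Prop :=
  ∀ (k : Type) [Field k] [CharP k p] (K : Type) [Field K] [Algebra k K] (A : Subalgebra k K), A.FG → IsFractionRing A K →
    ∀ g₀ : K, (∀ c : K, c ^ p ≠ g₀) →
    ∃ (D : Derivation ℤ K K) (s : K), s ≠ 0 ∧ (∀ y : K, y ∈ A → s * D y ∈ A) ∧ D g₀ ≠ 0

/-- **The census target `AbsDerivationMovesAt p` HOLDS for every prime `p`** — the `hD` input of the census certificates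
`derivationStub_of_absDerivation`, `arcConstants_of_absDerivation`, `arcInfinite_of_potential_of_absDerivation`,
`arcConstants_of_potential_of_absDerivation`, `cleanLU3DefectDiscrete_of_potential_of_absDerivation`. [folklore] -/
theorem absDerivationMovesAt_holds {p : ℕ} (hp : p.Prime) : AbsDerivationMovesAt p :=
  fun k _ _ K _ _ A hAfg hfrac g₀ hg => absDerivation_of_forall_pow_ne' p hp k K A hAfg hfrac g₀ hg

/-- **The lead's stub `stub_cleanLU3DefectArcConstants` (Sketch rev 20 l.232), statement verbatim, PROVED**: class (A), finite residue
tower, `g₀ ∈ k K^p ∖ K^p` — via LEMMA D-abs (unconditional) and the landed ✓ `cleanLU3Defect_of_discrete_of_finiteResidue`. [folklore] -/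
theorem cleanLU3DefectArcConstants :
    ∀ (p : ℕ), p.Prime →
    ∀ (k : Type) [Field k] [CharP k p] (K : Type) [Field K] [Algebra k K]
    (O : ValuationSubring K) (A : Subalgebra k K), A.toSubring ≤ O.toSubring → A.FG → IsFractionRing A K →
    ringKrullDim A ≤ 3 → IsRegularLocalRing (locAtCentre A.toSubring O) →
    ringKrullDim (locAtCentre A.toSubring O) = 3 →
    (∀ (T : Subring K) (hT : T ≤ O.toSubring), A.toSubring ≤ T → (subringCentre T O hT).IsMaximal) →
    ∀ g₀ : K, (∀ c : K, c ^ p ≠ g₀) →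
    (∀ f₀ : K, ∃ f₁ : K, O.valuation (g₀ - f₁ ^ p) < O.valuation (g₀ - f₀ ^ p)) →
    (∀ hk : ∀ c : k, algebraMap k K c ∈ O, transcendenceDefect k O hk ≠ 0) →
    (∃ π : K, π ≠ 0 ∧ (∀ x : K, O.valuation x < 1 → O.valuation x ≤ O.valuation π) ∧
      (∀ x : K, x ≠ 0 → ∃ n : ℕ, O.valuation π ^ n ≤ O.valuation x)) →
    (∃ S : Finset K, (↑S : Set K) ⊆ O ∧
      ∀ y : K, y ∈ O → ∃ r : K, r ∈ Subring.closure ((locAtCentre A.toSubring O : Set K) ∪ ↑S) ∧ O.valuation (y - r) < 1) →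
    g₀ ∈ Algebra.adjoin k (Set.range fun y : K => y ^ p) →
    ∃ (A' : Subalgebra k K), A'.toSubring ≤ O.toSubring ∧ A ≤ A' ∧ A'.FG ∧
    ∃ (_ : IsRegularLocalRing (locAtCentre A'.toSubring O)) (c : Fin p → K), (∃ j : Fin p, (j : ℕ) ≠ 0 ∧ c j ≠ 0) ∧
    ((∃ (d m : ℕ) (hmd : m ≤ d) (t : Fin d → ↥(locAtCentre A'.toSubring O)) (a : Fin m → ℕ) (u : ↥(locAtCentre A'.toSubring O)), IsUnit u ∧
    Ideal.span (Set.range t) = IsLocalRing.maximalIdeal ↥(locAtCentre A'.toSubring O) ∧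
    ringKrullDim ↥(locAtCentre A'.toSubring O) = (d : WithBot ℕ∞) ∧ 0 < m ∧ (∀ i, ¬ p ∣ a i) ∧
    (∑ j : Fin p, c j ^ p * g₀ ^ (j : ℕ)) = (u : K) * ∏ i : Fin m, ((t (Fin.castLE hmd i) : ↥(locAtCentre A'.toSubring O)) : K) ^ (a i)) ∨
    (∃ u : ↥(locAtCentre A'.toSubring O), IsUnit u ∧ (∑ j : Fin p, c j ^ p * g₀ ^ (j : ℕ)) = (u : K) ∧
    ∀ c' : ↥(locAtCentre A'.toSubring O), u - c' ^ p ∉ IsLocalRing.maximalIdeal ↥(locAtCentre A'.toSubring O)) ∨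
    (∃ s c' : ↥(locAtCentre A'.toSubring O), (∑ j : Fin p, c j ^ p * g₀ ^ (j : ℕ)) = (s : K) ∧
    s - c' ^ p ∈ IsLocalRing.maximalIdeal ↥(locAtCentre A'.toSubring O) ∧
    s - c' ^ p ∉ IsLocalRing.maximalIdeal ↥(locAtCentre A'.toSubring O) ^ 2)) := by
  intro p hp k _ _ K _ _ O A hAO hAfg hfrac hdimA hreg hdim3 hzd g₀ hg₀ hdefect htd hdisc hres _
  exact Summit.ResolutionOfSingularities.ResolutionOfSingularities.Theorems.RadicialJung.CleanModels.cleanLU3Defect_of_discrete_of_finiteResidue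
    p hp k K O A hAO hAfg hfrac hdimA hreg hdim3 hzd g₀ hg₀ hdefect htd hdisc hres
    (absDerivation_of_forall_pow_ne' p hp k K A hAfg hfrac g₀ hg₀)

end Summit.ResolutionOfSingularities.ResolutionOfSingularities.Cruxes.DescentPerfectToAll.CpSibling.AbsDerivation
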